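import Summits.QuantumFields.BalabanUV.Beta.D1BFx.CrossERest
import Summits.QuantumFields.BalabanUV.Beta.D1BFx.CornerRest

/-!
# `BalabanUV.Beta.D1BFx.RestConv` — road «BF-x» for binder row D1, slot (CONV) for EVERY REST WORD: the punctured partial sums of all 116 `RestIdx` word
# integrands `SplitInstance.restK … b τ` converge at every block size and base site — the `hKr` hypothesis of the owner's `AssemblyEnd.defect_le_at` (all
# `τ` at once) and the `hKr` binder of `Assembly.hT_of_slots` against `SplitPackaged.KrPk`, from the fixed-`n` data alone (spread leg, exponentially bounded
# profile, common-rate bi-localised slot tables, the corner's two weighted summabilities)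

HONEST DEPENDENCY (page 1, mandatory): continuum YM on T⁴ ⇐ BetaPertH ∧ nine spine estimates (0/9 proved); BetaPertH ⇐ (D1) ∧ (D4) ∧
CAP+tail; G-an2-4 gates asym, D1 and NE2/3/4.  HONEST FRAMING (cell contract, verbatim): «discharging `BetaPertH` makes Bałaban's UV
stability UNCONDITIONAL — a real constructive-QFT result; it is NOT the continuum limit and NOT the Clay problem.»  THIS MODULE DISCHARGES
NOTHING of the wall: [folklore] case analysis over `RestIdx` composed BY NAME from my lineage's A0-FINE (CONV) lemmas (`FineHessianLegGrades.conv_tadpoleTableA_graded`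
∕ `conv_biBubbleTable_graded`, `FineHessianGhostGrades.conv_tadpoleTableA_ghost` ∕ `conv_biBubbleTable_ghost`), `CrossERest.conv_restK_crossE`, the owner's
`CornerRest.summable_corner_weight` ∕ `ModelTablesRealised.stK_of_bfKernel` ∕ `Assembly.exists_tendsto_psum_const_mul`, an2's `WindowIdentification.exists_tendsto_psum_of_summable`.
No `def`, no `Prop` minted, nothing cited, 0 sorry.  NO BOUND is proved here — convergence only.  0 wall binders; NOT the (REST) bounds, NOT the (K) slot, NOT D1,
NOT `BetaPertH`, NOT continuum, NOT Clay.

ABSOLUTE RULE (cell charter, verbatim): «No internally-minted statement may enter as a cited fact. Every hypothesis is either kernel-proved in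
this package or a verbatim quotation of a PUBLISHED theorem with page reference. The manuscript(s) under audit are NOT citable for their own
disputed steps — they are the thing under adjudication; programme-internal (2001/route/tribunal) claims are never citable.»

WHY (owner d1-p2-g2, `AssemblyEnd.defect_le_at` p221972, hypothesis `hKr : ∀ τ : RestIdx, ∀ b ∈ image resSite, ∃ B, Tendsto (psum (fun w => restK … b τ w)) atTop (𝓝 B)`;
journal l.15450 «(CONV) + (REST) bounds for the `RestIdx` words … the rest OPEN, claimable by range»).  Every REST word is a scalar multiple of a (1.22)-weighted
base-point kernel of a fine tadpole or bubble table over SPREAD legs (`spr_legPiece`, `spr_ghLeg`) with LOCALISED stencils and tables — absolutely second-moment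
summable at each fixed block size (A0-FINE, per word) — except the corner word (two summable weighted `bfKernel` sums, the owner's `CornerRest` inputs `h2`∕`h1`)
and the crossE word (part 2's `conv_restK_crossE`).  So the (CONV) slot for the REST words is bookkeeping, uniformly closable NOW; this file closes it.
* `tendsto_psum_zero` (the `0000` words), `slot_biLoc` (the five slot hypotheses as a `Fin 5` family);
* **`conv_restK`** — (CONV) for every `τ : RestIdx` at fixed `(n, b)`; **`hKr_restK`** — the owner's `hKr` shape (every `τ`, every `b ∈ image resSite`, site-dependent profile `gp b`);
* **`hKr_packaged`** — the `hKr` binder of `Assembly.hT_of_slots` ∕ `abs_defect_le_of_slots` against `SplitPackaged.KrPk`, ∀ `n ≥ 2`, from n-indexed data.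
Unit `b2b-balaban-beta-d1-formalise-leaf-03` (gen 4), D1 formalisation swarm; `LEAVES-BFx.md` rows A7 ∕ (REST)∕(CONV) (sub-leaf «D1-BFx-REST-CONV»).
-/

noncomputable section

namespace Summit.QuantumFields.BalabanUV.Beta.D1BFx.RestConv

open Finset Filter Topology
open scoped BigOperators
open Literature.MathematicalPhysics.QuantumFieldTheory.Balaban1983to89
open Literature.MathematicalPhysics.QuantumFieldTheory.Balaban1983to89.Beta
open B12Sec2to5 (l1)
open ExpKernelCalculus (Site MKer BiLoc)
open DyadicShell (Pt toReal toReal_apply)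
open BubbleTransfer (unitVec)
open SpinTable (bfKernel)
open SquareTable (stK)
open WindowIdentification (psum psum_def exists_tendsto_psum_of_summable)
open DressedMomentNormalisation (resSite)
open Summit.QuantumFields.BalabanUV.Beta.TameKernelCalculus (Spr)
open Summit.QuantumFields.BalabanUV.Beta.D1BFx.GluonLeg (Ga)
open Summit.QuantumFields.BalabanUV.Beta.D1BFx.ReducedKernel (TableR)
open Summit.QuantumFields.BalabanUV.Beta.D1BFx.Assembly (exists_tendsto_psum_const_mul)
open Summit.QuantumFields.BalabanUV.Beta.D1BFx.ModelTablesRealised (stK_of_bfKernel)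
open Summit.QuantumFields.BalabanUV.Beta.D1BFx.FineHessianSectors (slotWt slotTab)
open Summit.QuantumFields.BalabanUV.Beta.D1BFx.FineHessianLegGrades (conv_tadpoleTableA_graded conv_biBubbleTable_graded)
open Summit.QuantumFields.BalabanUV.Beta.D1BFx.FineHessianGhostGrades (conv_tadpoleTableA_ghost conv_biBubbleTable_ghost)
open Summit.QuantumFields.BalabanUV.Beta.D1BFx.CornerRest (summable_corner_weight)
open Summit.QuantumFields.BalabanUV.Beta.D1BFx.SplitInstance (RestIdx restK)
open Summit.QuantumFields.BalabanUV.Beta.D1BFx.SplitPackaged (KrPk)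
open Summit.QuantumFields.BalabanUV.Beta.D1BFx.CrossERest (conv_restK_crossE)

/-- [folklore] The zero integrand has (trivially) convergent punctured partial sums. -/
theorem tendsto_psum_zero : ∃ B, Tendsto (psum (fun _ : Pt => (0 : ℝ))) atTop (𝓝 B) := by
  refine ⟨0, ?_⟩
  have e : psum (fun _ : Pt => (0 : ℝ)) = fun _ => 0 := funext fun R => by simp [psum_def]
  rw [e]
  exact tendsto_const_nhds

section Fixed

variable (n : ℕ) [NeZero n] (a : ℝ) {g : Pt → ℝ} (cE cΛ cR cK cQ cE₂ cJ4 cΛ₂ cR₂ cQ₂ x₀ : ℝ) {WE WJ WΛ WR WQ : TableR}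
  (ωgl ωgh lam N : ℝ) {μ ν : Fin 4} (b : Pt) {C δ CE CJ CΛt CRt CQ δW : ℝ}

/-- [folklore] The five slot-table localisation hypotheses (the owner's `AssemblyEnd.defect_le_at` shape: one rate `δW`, one constant per slot) as a `Fin 5` family. -/
theorem slot_biLoc (hE : ∀ κ u l u', BiLoc (WE κ u l u') u u' CE δW) (hJ : ∀ κ u l u', BiLoc (WJ κ u l u') u u' CJ δW)
    (hΛ : ∀ κ u l u', BiLoc (WΛ κ u l u') u u' CΛt δW) (hR : ∀ κ u l u', BiLoc (WR κ u l u') u u' CRt δW)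
    (hQ : ∀ κ u l u', BiLoc (WQ κ u l u') u u' CQ δW) (s : Fin 5) :
    ∃ Cs : ℝ, ∀ κ u l u', BiLoc (slotTab WE WJ WΛ WR WQ s κ u l u') u u' Cs δW := by
  fin_cases s
  · exact ⟨CE, hE⟩
  · exact ⟨CJ, hJ⟩
  · exact ⟨CΛt, hΛ⟩
  · exact ⟨CRt, hR⟩
  · exact ⟨CQ, hQ⟩

/-- [folklore] **(CONV) FOR EVERY REST WORD AT A FIXED BLOCK SIZE AND BASE SITE.**  Inputs: `0 < a`; T1's `Spr (Ga n a)`; an exponential bound on the profile `g`;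
the five slot tables bi-localised at their bonds at one rate `δW > 0`; `μ ≠ ν` and the corner's two weighted summabilities of `bfKernel g N u_μ u_ν` (the owner's
`CornerRest` inputs).  Output: `∃ B, Tendsto (psum (restK … b τ)) atTop (𝓝 B)` for every `τ : RestIdx`. -/
theorem conv_restK (ha : 0 < a) (hGa : Spr (Ga n a)) (hδ : 0 < δ) (hg : ∀ v, |g v| ≤ C * Real.exp (-δ * l1 v)) (hδW : 0 < δW)
    (hE : ∀ κ u l u', BiLoc (WE κ u l u') u u' CE δW) (hJ : ∀ κ u l u', BiLoc (WJ κ u l u') u u' CJ δW)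
    (hΛ : ∀ κ u l u', BiLoc (WΛ κ u l u') u u' CΛt δW) (hR : ∀ κ u l u', BiLoc (WR κ u l u') u u' CRt δW)
    (hQ : ∀ κ u l u', BiLoc (WQ κ u l u') u u' CQ δW) (hμν : μ ≠ ν)
    (h2 : Summable fun w : Pt => (w μ : ℝ) * (w ν : ℝ) * bfKernel g N (unitVec μ) (unitVec ν) w)
    (h1 : Summable fun w : Pt => (w ν : ℝ) * bfKernel g N (unitVec μ) (unitVec ν) w) (τ : RestIdx) :
    ∃ B, Tendsto (psum (restK n a g cE cΛ cR cK cQ cE₂ cJ4 cΛ₂ cR₂ cQ₂ x₀ WE WJ WΛ WR WQ ωgl ωgh lam N μ ν b τ)) atTop (𝓝 B) := by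
  rcases τ with x | x | r | x | k
  · -- gluon tadpole words `(s, r)`
    obtain ⟨Cs, hW⟩ := slot_biLoc hE hJ hΛ hR hQ x.1
    exact exists_tendsto_psum_const_mul _ (exists_tendsto_psum_const_mul _ (conv_tadpoleTableA_graded n a hGa hδ hg x.2 hW hδW μ ν b))
  · -- gluon bubble words `(i, j, r, r′)`
    by_cases hx : x = ((0 : Fin 3), (0 : Fin 3), (0 : Fin 3), (0 : Fin 3))
    · subst hx
      have e : restK n a g cE cΛ cR cK cQ cE₂ cJ4 cΛ₂ cR₂ cQ₂ x₀ WE WJ WΛ WR WQ ωgl ωgh lam N μ ν b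
          (Sum.inr (Sum.inl ((0 : Fin 3), (0 : Fin 3), (0 : Fin 3), (0 : Fin 3)))) = fun _ => 0 := by
        funext w; simp [restK]
      rw [e]; exact tendsto_psum_zero
    · have e : restK n a g cE cΛ cR cK cQ cE₂ cJ4 cΛ₂ cR₂ cQ₂ x₀ WE WJ WΛ WR WQ ωgl ωgh lam N μ ν b (Sum.inr (Sum.inl x)) = fun w =>
          ωgl * (GluonKernelSectors.secWt cE cΛ cR x.1 * GluonKernelSectors.secWt cE cΛ cR x.2.1 * (((n : ℝ) ^ 8)⁻¹ * (toReal w μ * toReal w ν *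
            MomentTransferPeriodic.baseKer (FineHessianSectors.biBubbleTable (FineHessianLegGrades.legPiece n a g x.2.2.1)
              (FineHessianLegGrades.legPiece n a g x.2.2.2) (GluonKernelSectors.secSt n a cK cQ x.1) (GluonKernelSectors.secSt n a cK cQ x.2.1) μ ν) b w))) := by
        funext w; simp only [restK, if_neg hx]
      rw [e]
      exact exists_tendsto_psum_const_mul _ (exists_tendsto_psum_const_mul _
        (conv_biBubbleTable_graded n a cK cQ ha hGa hδ hg x.2.2.1 x.2.2.2 x.1 x.2.1 μ ν b))
  · -- ghost tadpole words `r`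
    exact exists_tendsto_psum_const_mul _ (conv_tadpoleTableA_ghost n a cK cQ x₀ ha hδ hg r μ ν b)
  · -- ghost bubble words `(i, j, r, r′)`
    by_cases hx : x = ((0 : Fin 2), (0 : Fin 2), (0 : Fin 2), (0 : Fin 2))
    · subst hx
      have e : restK n a g cE cΛ cR cK cQ cE₂ cJ4 cΛ₂ cR₂ cQ₂ x₀ WE WJ WΛ WR WQ ωgl ωgh lam N μ ν b
          (Sum.inr (Sum.inr (Sum.inr (Sum.inl ((0 : Fin 2), (0 : Fin 2), (0 : Fin 2), (0 : Fin 2)))))) = fun _ => 0 := by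
        funext w; simp [restK]
      rw [e]; exact tendsto_psum_zero
    · have e : restK n a g cE cΛ cR cK cQ cE₂ cJ4 cΛ₂ cR₂ cQ₂ x₀ WE WJ WΛ WR WQ ωgl ωgh lam N μ ν b (Sum.inr (Sum.inr (Sum.inr (Sum.inl x)))) = fun w =>
          ωgh * (FineHessianGhostGrades.ghWt cK cQ x.1 * FineHessianGhostGrades.ghWt cK cQ x.2.1 * (((n : ℝ) ^ 8)⁻¹ * (toReal w μ * toReal w ν *
            MomentTransferPeriodic.baseKer (FineHessianSectors.biBubbleTable (FineHessianGhostGrades.ghLeg n a g x.2.2.1)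
              (FineHessianGhostGrades.ghLeg n a g x.2.2.2) (FineHessianGhostGrades.ghSec n x.1) (FineHessianGhostGrades.ghSec n x.2.1) μ ν) b w))) := by
        funext w; simp only [restK, if_neg hx]
      rw [e]
      exact exists_tendsto_psum_const_mul _ (exists_tendsto_psum_const_mul _
        (conv_biBubbleTable_ghost n a ha hδ hg x.2.2.1 x.2.2.2 x.1 x.2.1 μ ν b))
  · fin_cases k
    · -- the corner word: summable (corner-substituted weighted kernel minus `stK`)
      have hA : Summable fun w : Pt => ((n : ℝ) ^ 8)⁻¹ *
          (toReal w μ * toReal w ν * (lam * bfKernel g N (unitVec μ) (unitVec ν) (-w - unitVec μ))) := by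
        refine ((summable_corner_weight hμν h2 h1).mul_left (((n : ℝ) ^ 8)⁻¹ * lam)).congr fun w => ?_
        simp only [toReal_apply]; ring
      have hB : Summable fun w : Pt => stK μ ν N g w := by
        refine h2.congr fun w => ?_
        rw [stK_of_bfKernel]; simp only [toReal_apply]
      exact exists_tendsto_psum_of_summable _ (hA.sub hB)
    · -- the crossE word (part 2)
      exact conv_restK_crossE n cE ωgl μ ν a cΛ cR cK cQ cE₂ cJ4 cΛ₂ cR₂ cQ₂ x₀ WE WJ WΛ WR WQ ωgh lam N b hδ hg

/-- [folklore] **THE OWNER'S `hKr` AT FIXED `n`, ALL WORDS** (`AssemblyEnd.defect_le_at`'s hypothesis shape: site-dependent profile `gp b`, every `b ∈ image resSite`). -/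
theorem hKr_restK {gp : Pt → Pt → ℝ} (ha : 0 < a) (hGa : Spr (Ga n a))
    (hg : ∀ b : Pt, ∃ C δ : ℝ, 0 < δ ∧ ∀ v, |gp b v| ≤ C * Real.exp (-δ * l1 v)) (hδW : 0 < δW)
    (hE : ∀ κ u l u', BiLoc (WE κ u l u') u u' CE δW) (hJ : ∀ κ u l u', BiLoc (WJ κ u l u') u u' CJ δW)
    (hΛ : ∀ κ u l u', BiLoc (WΛ κ u l u') u u' CΛt δW) (hR : ∀ κ u l u', BiLoc (WR κ u l u') u u' CRt δW)
    (hQ : ∀ κ u l u', BiLoc (WQ κ u l u') u u' CQ δW) (hμν : μ ≠ ν)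
    (h2 : ∀ b, Summable fun w : Pt => (w μ : ℝ) * (w ν : ℝ) * bfKernel (gp b) N (unitVec μ) (unitVec ν) w)
    (h1 : ∀ b, Summable fun w : Pt => (w ν : ℝ) * bfKernel (gp b) N (unitVec μ) (unitVec ν) w) :
    ∀ τ : RestIdx, ∀ b ∈ (univ : Finset (Fin 4 → Fin n)).image resSite, ∃ B, Tendsto (psum (fun w : Pt =>
      restK n a (gp b) cE cΛ cR cK cQ cE₂ cJ4 cΛ₂ cR₂ cQ₂ x₀ WE WJ WΛ WR WQ ωgl ωgh lam N μ ν b τ w)) atTop (𝓝 B) := by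
  intro τ b _
  obtain ⟨C, δ, hδ, hgb⟩ := hg b
  exact conv_restK n a cE cΛ cR cK cQ cE₂ cJ4 cΛ₂ cR₂ cQ₂ x₀ ωgl ωgh lam N b ha hGa hδ hgb hδW hE hJ hΛ hR hQ hμν (h2 b) (h1 b) τ

end Fixed

section Packaged

variable {a : ℝ} {gp : ℕ → Pt → Pt → ℝ} {cE cVH cΛ cR cK cQ cE₂ cJ4 cΛ₂ cR₂ cQ₂ x₀ : ℕ → ℝ} {WE WJ WΛ WR WQ : ℕ → TableR}
  {ωgl ωgh lam : ℕ → ℝ} {N : ℝ} {μ ν : Fin 4} {CE CJ CΛt CRt CQ δW : ℕ → ℝ}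

/-- [folklore] **THE `hKr` BINDER OF `Assembly.hT_of_slots` ∕ `abs_defect_le_of_slots`, PACKAGED** (`T := RestIdx`, `Kr := SplitPackaged.KrPk …`, `Bset n = image resSite`),
from n-indexed fixed-`n` data: for every `n ≥ 2`, T1's `Spr (Ga n a)`, the profile bounds of `SplitPackaged.hsplit_packaged` (`hg`), the slot tables at `n`
bi-localised at one rate `δW n > 0`, and the corner's weighted summabilities at every base site. -/
theorem hKr_packaged (ha : 0 < a) (hGa : ∀ n : ℕ, 2 ≤ n → ∀ [NeZero n], Spr (Ga n a))
    (hg : ∀ n : ℕ, 2 ≤ n → ∀ b : Pt, ∃ C δ : ℝ, 0 < δ ∧ ∀ v, |gp n b v| ≤ C * Real.exp (-δ * l1 v)) (hδW : ∀ n, 0 < δW n)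
    (hE : ∀ n κ u l u', BiLoc (WE n κ u l u') u u' (CE n) (δW n)) (hJ : ∀ n κ u l u', BiLoc (WJ n κ u l u') u u' (CJ n) (δW n))
    (hΛ : ∀ n κ u l u', BiLoc (WΛ n κ u l u') u u' (CΛt n) (δW n)) (hR : ∀ n κ u l u', BiLoc (WR n κ u l u') u u' (CRt n) (δW n))
    (hQ : ∀ n κ u l u', BiLoc (WQ n κ u l u') u u' (CQ n) (δW n)) (hμν : μ ≠ ν)
    (h2 : ∀ n : ℕ, 2 ≤ n → ∀ b, Summable fun w : Pt => (w μ : ℝ) * (w ν : ℝ) * bfKernel (gp n b) N (unitVec μ) (unitVec ν) w)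
    (h1 : ∀ n : ℕ, 2 ≤ n → ∀ b, Summable fun w : Pt => (w ν : ℝ) * bfKernel (gp n b) N (unitVec μ) (unitVec ν) w) :
    ∀ (τ : RestIdx) (n : ℕ), 2 ≤ n → ∀ b ∈ (univ : Finset (Fin 4 → Fin n)).image resSite, ∃ B,
      Tendsto (psum (KrPk a gp cE cΛ cR cK cQ cE₂ cJ4 cΛ₂ cR₂ cQ₂ x₀ WE WJ WΛ WR WQ ωgl ωgh lam N μ ν τ n b)) atTop (𝓝 B) := by
  intro τ n hn b _
  have h1n : 1 ≤ n := le_trans one_le_two hn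
  haveI : NeZero n := ⟨Nat.one_le_iff_ne_zero.mp h1n⟩
  obtain ⟨C, δ, hδ, hgb⟩ := hg n hn b
  have e : KrPk a gp cE cΛ cR cK cQ cE₂ cJ4 cΛ₂ cR₂ cQ₂ x₀ WE WJ WΛ WR WQ ωgl ωgh lam N μ ν τ n b =
      restK n a (gp n b) (cE n) (cΛ n) (cR n) (cK n) (cQ n) (cE₂ n) (cJ4 n) (cΛ₂ n) (cR₂ n) (cQ₂ n) (x₀ n) (WE n) (WJ n) (WΛ n) (WR n) (WQ n)
        (ωgl n) (ωgh n) (lam n) N μ ν b τ := by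
    funext w; simp only [KrPk, dif_pos h1n]
  rw [e]
  exact conv_restK n a (cE n) (cΛ n) (cR n) (cK n) (cQ n) (cE₂ n) (cJ4 n) (cΛ₂ n) (cR₂ n) (cQ₂ n) (x₀ n) (ωgl n) (ωgh n) (lam n) N b ha (hGa n hn)
    hδ hgb (hδW n) (hE n) (hJ n) (hΛ n) (hR n) (hQ n) hμν (h2 n hn b) (h1 n hn b) τ

end Packaged

end Summit.QuantumFields.BalabanUV.Beta.D1BFx.RestConv

end
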